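import Summits.QuantumFields.QCD.Theorems.PauliWegnerSeaFMClosureUnquenchedTwoStarC1Aux5

/-!
# Crux `FMClosureUnquenched` (stmt-QuantumFields-11512), line `von-mises-circles`, stub `stub_twoStar` —
helper 7: clause (T1) of `TwoStarBounds`

* (T1) (`fibre_T1`, `T1_global`): on the two-star fibre of `u', v` alone the inside factor `‖G_W(x,u)‖₁^s`
  (`W = ebox(x,ℓ)`) and the far factor `‖G_{Λᶜ}(v',y)‖₁^s` (`Λ = ebox(x,3ℓ+2)`) are CONSTANT — every link of the
  two stars has `u'` or `v` as an endpoint, `u', v ∉ W` and `u', v ∈ Λ`, and a side matrix reads only links with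
  both endpoints on its side (`sideMatrix_wilsonD_refit_eq`); so the middle factor is removed by ASFH Lemma 4 on
  that fibre (`fibre_T5_inv`) and the constants are re-inserted (ASFH (2.17), conditional form).

References: Aizenman–Schenker–Friedrich–Hundertmark, CMP 224 (2001) 219, Lemmas 5–6, eq. (2.17) [AizenmanEtAl2001].
-/

noncomputable section

open scoped BigOperators ENNReal
open MeasureTheory
open Literature.MathematicalPhysics.QuantumFieldTheory Literature.MathematicalPhysics.QuantumLattice
  Literature.Probability.LatticeModels
open Summit.QuantumFields.QCD.Theorems.VonMisesCircles

namespace Summit.QuantumFields.QCD.Theorems.VonMisesCirclesC1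

section TwoStar

variable {Nf : ℕ} {s₁ C₁ p₁ C₀ m₀ : ℝ}

variable (hB : ∀ (N : ℕ) [NeZero N] (R : Finset (Edge 4 N)), R.card ≤ 32 →
    ∀ (U : GaugeConfig 4 N (Matrix.specialUnitaryGroup (Fin 3) ℂ)) (β : ℝ)
      (P Q : GaugeConfig 4 N (Matrix.specialUnitaryGroup (Fin 3) ℂ) → ℂ),
      IsFibrePoly (4 * Nf + 4) P → IsFibrePoly (4 * Nf + 4) Q →
      let refit : GaugeConfig 4 N (Matrix.specialUnitaryGroup (Fin 3) ℂ) →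
          GaugeConfig 4 N (Matrix.specialUnitaryGroup (Fin 3) ℂ) := fun W e => if e ∈ R then W e else U e
      let wt : GaugeConfig 4 N (Matrix.specialUnitaryGroup (Fin 3) ℂ) → ℝ := fun W =>
        Real.exp (-(β * wilsonAction (fundamentalRep (Fin 3)) (refit W))) * ‖P (refit W)‖
      let haar : Measure (GaugeConfig 4 N (Matrix.specialUnitaryGroup (Fin 3) ℂ)) :=
        Measure.pi fun _ => haarProbability (Matrix.specialUnitaryGroup (Fin 3) ℂ)
      let Z : ℝ := ∫ W, wt W ∂haar
      (∃ W, P (refit W) ≠ 0) →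
        ((∃ W, Q (refit W) ≠ 0) → ∀ᵐ W ∂haar, Q (refit W) ≠ 0) ∧
        (∀ W₀ : GaugeConfig 4 N (Matrix.specialUnitaryGroup (Fin 3) ℂ),
          ‖Q (refit W₀)‖ ≤ C₁ * (1 + |β|) ^ p₁ * ((∫ W, ‖Q (refit W)‖ * wt W ∂haar) / Z)) ∧
        (∀ s : ℝ, 0 < s → s ≤ s₁ →
          Integrable (fun W => ‖Q (refit W)‖ ^ (-s) * wt W) haar ∧
          (∫ W, ‖Q (refit W)‖ ^ (-s) * wt W ∂haar) / Z ≤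
            C₁ * (1 + |β|) ^ p₁ *
              (⨆ W : GaugeConfig 4 N (Matrix.specialUnitaryGroup (Fin 3) ℂ), ‖Q (refit W)‖) ^ (-s)))
  (hC₁ : 0 < C₁) (hC₀ : 0 < C₀)
  (hC : ∀ (S : ℕ) (A : Finset (TorusSite 4 (2 * S + 1))), AdmissibleSide S A →
      ∀ (x y : TorusSite 4 (2 * S + 1)), x ∈ A → y ∈ A →
      ∀ (R : Finset (Edge 4 (2 * S + 1))),
        (∀ e : Edge 4 (2 * S + 1),
          (e.1 = x ∨ Site.shift e.1 e.2 = x ∨ e.1 = y ∨ Site.shift e.1 e.2 = y) → e ∈ R) →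
      ∀ (U W : GaugeConfig 4 (2 * S + 1) (Matrix.specialUnitaryGroup (Fin 3) ℂ)),
        blockNorm ((sideMatrix A (wilsonD (fun e => if e ∈ R then W e else U e) m₀)).adjugate) x y ≤
          C₀ * ⨆ W' : GaugeConfig 4 (2 * S + 1) (Matrix.specialUnitaryGroup (Fin 3) ℂ),
            ‖(sideMatrix A (wilsonD (fun e => if e ∈ R then W' e else U e) m₀)).det‖)

include hB hC₁ hC₀ hC

/-- **Fibre form of (T1)**: on the two-star fibre of `u', v` (`u', v ∉ W := ebox(x,ℓ)`, `u', v ∈ Λ := ebox(x,3ℓ+2)`)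
the inside and far factors are constant, and the middle factor is removed by ASFH Lemma 4. [folklore] -/
theorem fibre_T1 {S : ℕ} (β : ℝ) (mq : Fin Nf → ℝ) (x : TorusSite 4 (2 * S + 1)) (ℓ : ℕ)
    (u u' v v' y : TorusSite 4 (2 * S + 1))
    (hu'Λ : u' ∈ ebox S x (3 * ℓ + 2)) (hu'W : u' ∉ ebox S x ℓ) (hvΛ : v ∈ ebox S x (3 * ℓ + 2))
    (hvW : v ∉ ebox S x ℓ) (s : ℝ) (hs : 0 < s) (hss : s ≤ s₁)
    (U : GaugeConfig 4 (2 * S + 1) (Matrix.specialUnitaryGroup (Fin 3) ℂ)) :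
    let R : Finset (Edge 4 (2 * S + 1)) := Finset.univ.filter fun e : Edge 4 (2 * S + 1) =>
      e.1 = u' ∨ Site.shift e.1 e.2 = u' ∨ e.1 = v ∨ Site.shift e.1 e.2 = v
    ∫⁻ W, ENNReal.ofReal (Real.exp (-(β * wilsonAction (fundamentalRep (Fin 3))
          (fun e => if e ∈ R then W e else U e))) *
        ‖(diracMatrix (fun e => if e ∈ R then W e else U e) mq).det‖ *
        (blockNorm (gside (ebox S x ℓ) (wilsonD (fun e => if e ∈ R then W e else U e) m₀)) x u ^ s *
          blockNorm (wilsonD (fun e => if e ∈ R then W e else U e) m₀)⁻¹ u' v ^ s *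
          blockNorm (gside (ebox S x (3 * ℓ + 2))ᶜ (wilsonD (fun e => if e ∈ R then W e else U e) m₀)) v' y ^ s))
      ∂(Measure.pi fun _ : Edge 4 (2 * S + 1) => haarProbability (Matrix.specialUnitaryGroup (Fin 3) ℂ)) ≤
    ENNReal.ofReal (C₀ ^ s * (C₁ * (1 + |β|) ^ p₁)) *
      ∫⁻ W, ENNReal.ofReal (Real.exp (-(β * wilsonAction (fundamentalRep (Fin 3))
          (fun e => if e ∈ R then W e else U e))) *
        ‖(diracMatrix (fun e => if e ∈ R then W e else U e) mq).det‖ *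
        (blockNorm (gside (ebox S x ℓ) (wilsonD (fun e => if e ∈ R then W e else U e) m₀)) x u ^ s *
          blockNorm (gside (ebox S x (3 * ℓ + 2))ᶜ (wilsonD (fun e => if e ∈ R then W e else U e) m₀)) v' y ^ s))
      ∂(Measure.pi fun _ : Edge 4 (2 * S + 1) => haarProbability (Matrix.specialUnitaryGroup (Fin 3) ℂ)) := by
  intro R
  have hRcard : R.card ≤ 32 := (card_filter_twoStar_le u' v).trans (by norm_num)
  have hR : ∀ e : Edge 4 (2 * S + 1),
      (e.1 = u' ∨ Site.shift e.1 e.2 = u' ∨ e.1 = v ∨ Site.shift e.1 e.2 = v) → e ∈ R := fun e he =>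
    Finset.mem_filter.2 ⟨Finset.mem_univ _, he⟩
  have hRmem : ∀ e ∈ R, e.1 = u' ∨ Site.shift e.1 e.2 = u' ∨ e.1 = v ∨ Site.shift e.1 e.2 = v := fun e he =>
    (Finset.mem_filter.1 he).2
  -- the inside and far factors are constant on the fibre
  have hIn : ∀ W : GaugeConfig 4 (2 * S + 1) (Matrix.specialUnitaryGroup (Fin 3) ℂ),
      gside (ebox S x ℓ) (wilsonD (fun e => if e ∈ R then W e else U e) m₀) = gside (ebox S x ℓ) (wilsonD U m₀) := by
    intro W
    unfold gside
    rw [sideMatrix_wilsonD_refit_eq (ebox S x ℓ) R (fun e he => not_both_mem_of_twoStar hu'W hvW e (hRmem e he))]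
  have hFar : ∀ W : GaugeConfig 4 (2 * S + 1) (Matrix.specialUnitaryGroup (Fin 3) ℂ),
      gside (ebox S x (3 * ℓ + 2))ᶜ (wilsonD (fun e => if e ∈ R then W e else U e) m₀) =
        gside (ebox S x (3 * ℓ + 2))ᶜ (wilsonD U m₀) := by
    intro W
    unfold gside
    rw [sideMatrix_wilsonD_refit_eq (ebox S x (3 * ℓ + 2))ᶜ R
      (fun e he => not_both_mem_compl_of_twoStar hu'Λ hvΛ e (hRmem e he))]
  simp_rw [hIn, hFar]
  -- abbreviate the constant factors
  set cI : ℝ := blockNorm (gside (ebox S x ℓ) (wilsonD U m₀)) x u ^ s with hcI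
  set cF : ℝ := blockNorm (gside (ebox S x (3 * ℓ + 2))ᶜ (wilsonD U m₀)) v' y ^ s with hcF
  have hcI0 : 0 ≤ cI := Real.rpow_nonneg (blockNorm_nonneg _ _ _) _
  have hcF0 : 0 ≤ cF := Real.rpow_nonneg (blockNorm_nonneg _ _ _) _
  have hmid := fibre_T5_inv hB hC₁ hC₀ hC β mq u' v R hRcard hR s hs hss U
  have hSm := measurable_wilsonAction (d := 4) (L := 2 * S + 1) (fundamentalRep (Fin 3))
    (continuous_fundamentalRep (Fin 3))
  have hdm := measurable_norm_det_diracMatrix (S := 2 * S + 1) mq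
  have hTm := measurable_refit R U
  have hwm : Measurable fun W : GaugeConfig 4 (2 * S + 1) (Matrix.specialUnitaryGroup (Fin 3) ℂ) =>
      ENNReal.ofReal (Real.exp (-(β * wilsonAction (fundamentalRep (Fin 3)) (fun e => if e ∈ R then W e else U e))) *
        ‖(diracMatrix (fun e => if e ∈ R then W e else U e) mq).det‖) :=
    ((Real.measurable_exp.comp ((hSm.comp hTm).const_mul β).neg).mul (hdm.comp hTm)).ennreal_ofReal
  have hMm : Measurable fun W : GaugeConfig 4 (2 * S + 1) (Matrix.specialUnitaryGroup (Fin 3) ℂ) =>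
      ENNReal.ofReal (Real.exp (-(β * wilsonAction (fundamentalRep (Fin 3)) (fun e => if e ∈ R then W e else U e))) *
        ‖(diracMatrix (fun e => if e ∈ R then W e else U e) mq).det‖ *
        blockNorm (wilsonD (fun e => if e ∈ R then W e else U e) m₀)⁻¹ u' v ^ s) :=
    (((Real.measurable_exp.comp ((hSm.comp hTm).const_mul β).neg).mul (hdm.comp hTm)).mul
      (((measurable_blockNorm_inv_wilsonD m₀ u' v).comp hTm).pow_const s)).ennreal_ofReal
  -- pull the constants out, apply the middle-factor bound, push the constants back
  have e1 : ∀ W : GaugeConfig 4 (2 * S + 1) (Matrix.specialUnitaryGroup (Fin 3) ℂ),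
      ENNReal.ofReal (Real.exp (-(β * wilsonAction (fundamentalRep (Fin 3)) (fun e => if e ∈ R then W e else U e))) *
        ‖(diracMatrix (fun e => if e ∈ R then W e else U e) mq).det‖ *
        (cI * blockNorm (wilsonD (fun e => if e ∈ R then W e else U e) m₀)⁻¹ u' v ^ s * cF)) =
      ENNReal.ofReal (cI * cF) *
        ENNReal.ofReal (Real.exp (-(β * wilsonAction (fundamentalRep (Fin 3)) (fun e => if e ∈ R then W e else U e))) *
          ‖(diracMatrix (fun e => if e ∈ R then W e else U e) mq).det‖ *
          blockNorm (wilsonD (fun e => if e ∈ R then W e else U e) m₀)⁻¹ u' v ^ s) := fun W => by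
    rw [← ENNReal.ofReal_mul (mul_nonneg hcI0 hcF0)]
    congr 1
    ring
  have e2 : ∀ W : GaugeConfig 4 (2 * S + 1) (Matrix.specialUnitaryGroup (Fin 3) ℂ),
      ENNReal.ofReal (Real.exp (-(β * wilsonAction (fundamentalRep (Fin 3)) (fun e => if e ∈ R then W e else U e))) *
        ‖(diracMatrix (fun e => if e ∈ R then W e else U e) mq).det‖ * (cI * cF)) =
      ENNReal.ofReal (cI * cF) *
        ENNReal.ofReal (Real.exp (-(β * wilsonAction (fundamentalRep (Fin 3)) (fun e => if e ∈ R then W e else U e))) *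
          ‖(diracMatrix (fun e => if e ∈ R then W e else U e) mq).det‖) := fun W => by
    rw [← ENNReal.ofReal_mul (mul_nonneg hcI0 hcF0)]
    congr 1
    ring
  simp_rw [e1, e2]
  rw [lintegral_const_mul _ hMm, lintegral_const_mul _ hwm]
  calc ENNReal.ofReal (cI * cF) * ∫⁻ W, ENNReal.ofReal (Real.exp (-(β * wilsonAction (fundamentalRep (Fin 3))
            (fun e => if e ∈ R then W e else U e))) *
          ‖(diracMatrix (fun e => if e ∈ R then W e else U e) mq).det‖ *
          blockNorm (wilsonD (fun e => if e ∈ R then W e else U e) m₀)⁻¹ u' v ^ s)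
        ∂(Measure.pi fun _ : Edge 4 (2 * S + 1) => haarProbability (Matrix.specialUnitaryGroup (Fin 3) ℂ))
      ≤ ENNReal.ofReal (cI * cF) * (ENNReal.ofReal (C₀ ^ s * (C₁ * (1 + |β|) ^ p₁)) *
          ∫⁻ W, ENNReal.ofReal (Real.exp (-(β * wilsonAction (fundamentalRep (Fin 3))
            (fun e => if e ∈ R then W e else U e))) *
          ‖(diracMatrix (fun e => if e ∈ R then W e else U e) mq).det‖)
        ∂(Measure.pi fun _ : Edge 4 (2 * S + 1) => haarProbability (Matrix.specialUnitaryGroup (Fin 3) ℂ))) := by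
        gcongr
    _ = _ := by ring

/-- **Clause (T1) of `TwoStarBounds`** (ASFH Lemma 5 / (2.17), averaged): spanning-factor removal between the two
cuts of the thick collar, for `0 < s`, `3s ≤ s₁`. [folklore] -/
theorem T1_global {S : ℕ} (β : ℝ) (mq : Fin Nf → ℝ) (x : TorusSite 4 (2 * S + 1)) (ℓ : ℕ) (hℓ : 1 ≤ ℓ)
    (hℓS : 3 * ℓ + 4 ≤ S) (u u' v v' y : TorusSite 4 (2 * S + 1))
    (hu'Λ : u' ∈ ebox S x (3 * ℓ + 2)) (hu'W : u' ∉ ebox S x ℓ) (hvΛ : v ∈ ebox S x (3 * ℓ + 2))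
    (hvW : v ∉ ebox S x ℓ) (s : ℝ) (hs : 0 < s) (hs3 : 3 * s ≤ s₁) :
    pqE Nf S β mq (fun U =>
        blockNorm (gside (ebox S x ℓ) (wilsonD U m₀)) x u ^ s *
          blockNorm (wilsonD U m₀)⁻¹ u' v ^ s *
          blockNorm (gside (ebox S x (3 * ℓ + 2))ᶜ (wilsonD U m₀)) v' y ^ s) ≤
      C₀ ^ s * (C₁ * (1 + |β|) ^ p₁) *
        pqE Nf S β mq (fun U =>
          blockNorm (gside (ebox S x ℓ) (wilsonD U m₀)) x u ^ s *
            blockNorm (gside (ebox S x (3 * ℓ + 2))ᶜ (wilsonD U m₀)) v' y ^ s) := by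
  have hss : s ≤ s₁ := by linarith
  have hAW : AdmissibleSide S (ebox S x ℓ) := Or.inr ⟨x, ℓ, hℓ, by omega, Or.inl rfl⟩
  have hAΛ : AdmissibleSide S (ebox S x (3 * ℓ + 2))ᶜ := Or.inr ⟨x, 3 * ℓ + 2, by omega, by omega, Or.inr (Or.inl rfl)⟩
  -- integrability of the reference product (two factors, the third exponent `0`)
  have hGi : Integrable (fun U : GaugeConfig 4 (2 * S + 1) (Matrix.specialUnitaryGroup (Fin 3) ℂ) =>
      ‖(diracMatrix U mq).det‖ *
        (blockNorm (gside (ebox S x ℓ) (wilsonD U m₀)) x u ^ s *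
          blockNorm (gside (ebox S x (3 * ℓ + 2))ᶜ (wilsonD U m₀)) v' y ^ s))
      (wilsonMeasure (d := 4) (L := 2 * S + 1) (fundamentalRep (Fin 3)) β) := by
    have h := integrable_T0_triple hB hC₁ hC₀ hC β mq s s 0 hs.le hs3 hs.le hs3 le_rfl (by linarith)
      (ebox S x ℓ) (ebox S x (3 * ℓ + 2))ᶜ Finset.univ hAW hAΛ (Or.inl rfl) x u v' y x x
    refine h.congr (ae_of_all _ fun U => ?_)
    simp only [Real.rpow_zero, mul_one]
  set R : Finset (Edge 4 (2 * S + 1)) := Finset.univ.filter fun e : Edge 4 (2 * S + 1) =>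
    e.1 = u' ∨ Site.shift e.1 e.2 = u' ∨ e.1 = v ∨ Site.shift e.1 e.2 = v with hRdef
  refine pqE_le_mul_pqE_of_fibre_bound β mq _ _
    (fun U => mul_nonneg (mul_nonneg (Real.rpow_nonneg (blockNorm_nonneg _ _ _) _)
      (Real.rpow_nonneg (blockNorm_nonneg _ _ _) _)) (Real.rpow_nonneg (blockNorm_nonneg _ _ _) _))
    (fun U => mul_nonneg (Real.rpow_nonneg (blockNorm_nonneg _ _ _) _) (Real.rpow_nonneg (blockNorm_nonneg _ _ _) _))
    ((((measurable_blockNorm_gside _ m₀ x u).pow_const s).mul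
      ((measurable_blockNorm_inv_wilsonD m₀ u' v).pow_const s)).mul
      ((measurable_blockNorm_gside _ m₀ v' y).pow_const s))
    (((measurable_blockNorm_gside _ m₀ x u).pow_const s).mul ((measurable_blockNorm_gside _ m₀ v' y).pow_const s))
    hGi (mul_nonneg (Real.rpow_nonneg hC₀.le _) (mul_nonneg hC₁.le (Real.rpow_nonneg (by positivity) _))) R
    fun U => ?_
  exact fibre_T1 hB hC₁ hC₀ hC β mq x ℓ u u' v v' y hu'Λ hu'W hvΛ hvW s hs hss U

end TwoStar

/-- **Registered helper `stub_twoStar_aux7` of crux stmt-QuantumFields-11512** (line `von-mises-circles`, stub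
`stub_twoStar`): clause (T1) of `TwoStarBounds` on its own (the side hypotheses on `v', y` are not needed), from the
fibre band law and K1♭. [folklore] -/
theorem stub_twoStar_aux7 : FibreBandLaw → LocalCofactorDomination → ∀ (Nf : ℕ), ∃ s₁ K p : ℝ, 0 < s₁ ∧ 0 < K ∧ ∀ (S : ℕ) (β : ℝ) (mq : Fin Nf → ℝ) (f : Fin Nf), -9 ≤ mq f → mq f ≤ 1 → ∀ (x : TorusSite 4 (2 * S + 1)) (ℓ : ℕ), 1 ≤ ℓ → 3 * ℓ + 4 ≤ S → ∀ u u' v v' y : TorusSite 4 (2 * S + 1), u' ∈ ebox S x (3 * ℓ + 2) → u' ∉ ebox S x ℓ → v ∈ ebox S x (3 * ℓ + 2) → v ∉ ebox S x ℓ → ∀ (s : ℝ), 0 < s → s ≤ s₁ → pqE Nf S β mq (fun U => blockNorm (gside (ebox S x ℓ) (wilsonD U (mq f))) x u ^ s * blockNorm (wilsonD U (mq f))⁻¹ u' v ^ s * blockNorm (gside (ebox S x (3 * ℓ + 2))ᶜ (wilsonD U (mq f))) v' y ^ s) ≤ K ^ s * (K * (1 + |β|) ^ p) * pqE Nf S β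 mq (fun U => blockNorm (gside (ebox S x ℓ) (wilsonD U (mq f))) x u ^ s * blockNorm (gside (ebox S x (3 * ℓ + 2))ᶜ (wilsonD U (mq f))) v' y ^ s) := by
  intro hFBL hK1 Nf
  obtain ⟨sB, C₁, p₁, hsB, hC₁, hB⟩ := hFBL 32 (4 * Nf + 4)
  obtain ⟨C₀, hC₀, hK⟩ := adj_blockNorm_le_sup_of_localCofactorDomination hK1
  refine ⟨sB / 3, max C₀ C₁, p₁, by linarith, lt_max_of_lt_left hC₀, ?_⟩
  intro S β mq f hm₁ hm₂ x ℓ hℓ hℓS u u' v v' y hu'Λ hu'W hvΛ hvW s hs hsle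
  have hs3 : 3 * s ≤ sB := by linarith
  refine (T1_global hB hC₁ hC₀ (hK (mq f) hm₁ hm₂) β mq x ℓ hℓ hℓS u u' v v' y hu'Λ hu'W hvΛ hvW s hs hs3).trans ?_
  refine mul_le_mul_of_nonneg_right ?_ (div_nonneg (integral_nonneg fun U => mul_nonneg (norm_nonneg _)
    (mul_nonneg (Real.rpow_nonneg (blockNorm_nonneg _ _ _) _) (Real.rpow_nonneg (blockNorm_nonneg _ _ _) _)))
    (integral_nonneg fun _ => norm_nonneg _))
  have hB0 : 0 ≤ (1 + |β|) ^ p₁ := Real.rpow_nonneg (by positivity) _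
  exact mul_le_mul (Real.rpow_le_rpow hC₀.le (le_max_left _ _) hs.le)
    (mul_le_mul_of_nonneg_right (le_max_right _ _) hB0) (mul_nonneg hC₁.le hB0)
    (Real.rpow_nonneg (hC₀.le.trans (le_max_left _ _)) _)

end Summit.QuantumFields.QCD.Theorems.VonMisesCirclesC1
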